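import Mathlib
import Literature.Geometry.Riemannian.AHRiccatiEstimates
import Summits.SmoothPoincare4.SmoothPoincare4.Theorems.InformationMetricHadamardYamabePinchedEinsteinBulkStubWeylTracefreeRiccati

/-!
# Crux `YamabePinchedEinsteinBulk` (stmt-SmoothPoincare4-7996), line `Sketch`: the ray-window
identity (helper `helper_rayWindowIdentity`)

Card `tracefree-riccati-defect`, step K3 (matrix layer): along a ray the radial Weyl curvature
`⟨𝒲 e, e⟩` lies in `W^{-1,1}` of the ray with the trace-free shape operator as primitive. From the
landed extraction `𝒲 = −(𝒰' − (tr 𝒰'/4) I) − (tr 𝒰/2) 𝒰° − ((𝒰°)² − (tr (𝒰°)²/4) I)`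
(`stub_weylTracefreeRiccati`, `𝒰° = 𝒰 − (tr 𝒰/4) I`) and `(𝒰°)' = 𝒰' − (tr 𝒰'/4) I`, one
integration by parts against a `C¹` window `η` vanishing at the end points gives

  `∫ η ⟨𝒲e, e⟩ = ∫ ( η' ⟨𝒰°e, e⟩ − η (tr 𝒰/2) ⟨𝒰°e, e⟩ − η ⟨((𝒰°)² − (tr (𝒰°)²/4) I) e, e⟩ )`,

so that `|∫ η ⟨𝒲e,e⟩|` is controlled by `∫ |𝒰°|` and `∫ |𝒰°|²` on the window (and hence, by
`helper_defectBudget`, by the Bishop defect budget `∫ D`).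

* `hasDerivAt_tracefree` — `(𝒰°)' = 𝒰' − (tr 𝒰'/4) I` along a differentiable matrix curve;
* `helper_rayWindowIdentity` — the registered helper.
Everything is proved (kind = proof); no definitions.
-/

noncomputable section

-- the prescribed namespace `Summit.<P>.<Sub>.…` duplicates `SmoothPoincare4` (P = Sub)
set_option linter.dupNamespace false

open Set MeasureTheory intervalIntegral

namespace Summit.SmoothPoincare4.SmoothPoincare4.Cruxes.YamabePinchedEinsteinBulk.Sketch

open Literature.Geometry.Riemannian (hasDerivAt_matrix_trace)
open Literature.Geometry.Riemannian.AHRiccati (hasDerivAt_dotProduct_mulVec)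

/-- Along a differentiable curve of `4 × 4` matrices, the trace-free part
`𝒰° = 𝒰 − (tr 𝒰/4) I` has derivative `𝒰' − (tr 𝒰'/4) I`. [folklore] -/
theorem hasDerivAt_tracefree {U : ℝ → Matrix (Fin 4) (Fin 4) ℝ} {U' : Matrix (Fin 4) (Fin 4) ℝ}
    {t : ℝ} (hU : HasDerivAt U U' t) :
    HasDerivAt (fun s => U s - ((U s).trace / 4) • (1 : Matrix (Fin 4) (Fin 4) ℝ))
      (U' - (U'.trace / 4) • (1 : Matrix (Fin 4) (Fin 4) ℝ)) t := by
  -- a normed structure on the matrices (Mathlib's scoped `L∞` operator norm; its topology is the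
  -- product topology of the statement, definitionally)
  open scoped Matrix.Norms.Operator in
  exact hU.sub (((hasDerivAt_matrix_trace hU).div_const 4).smul_const _)

/-- **The ray-window identity (registered helper `helper_rayWindowIdentity` of line `Sketch`).**
Let `𝒰` solve the Einstein Riccati equation `𝒰' = 1 − 𝒲(t) − 𝒰²` on `[t₁, t₂]` with `𝒲`
continuous and trace-free, and let `η` be `C¹` on `[t₁, t₂]` (continuous derivative `η'`) with
`η(t₁) = η(t₂) = 0`. Then for every `e ∈ ℝ⁴`, with `𝒰° = 𝒰 − (tr 𝒰/4) I`,
`∫_{t₁}^{t₂} η ⟨𝒲 e, e⟩ = ∫_{t₁}^{t₂} ( η' ⟨𝒰° e, e⟩ − η (tr 𝒰/2) ⟨𝒰° e, e⟩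
  − η ⟨((𝒰°)² − (tr (𝒰°)²/4) I) e, e⟩ )`. [folklore] -/
theorem helper_rayWindowIdentity :
    ∀ (U W : ℝ → Matrix (Fin 4) (Fin 4) ℝ) (η η' : ℝ → ℝ) (t₁ t₂ : ℝ) (e : Fin 4 → ℝ), t₁ ≤ t₂ →
      (∀ t ∈ Set.Icc t₁ t₂, HasDerivAt U (-(-1 + W t) - U t * U t) t) →
      (∀ t ∈ Set.Icc t₁ t₂, (W t).trace = 0) → ContinuousOn W (Set.Icc t₁ t₂) →
      (∀ t ∈ Set.Icc t₁ t₂, HasDerivAt η (η' t) t) → ContinuousOn η' (Set.Icc t₁ t₂) →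
      η t₁ = 0 → η t₂ = 0 →
      ∫ t in t₁..t₂, η t * dotProduct e (Matrix.mulVec (W t) e) =
        ∫ t in t₁..t₂,
          (η' t * dotProduct e
              (Matrix.mulVec (U t - ((U t).trace / 4) • (1 : Matrix (Fin 4) (Fin 4) ℝ)) e)
            - η t * ((U t).trace / 2) * dotProduct e
              (Matrix.mulVec (U t - ((U t).trace / 4) • (1 : Matrix (Fin 4) (Fin 4) ℝ)) e)
            - η t * dotProduct e (Matrix.mulVec
                ((U t - ((U t).trace / 4) • (1 : Matrix (Fin 4) (Fin 4) ℝ)) *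
                    (U t - ((U t).trace / 4) • (1 : Matrix (Fin 4) (Fin 4) ℝ))
                  - ((((U t - ((U t).trace / 4) • (1 : Matrix (Fin 4) (Fin 4) ℝ)) *
                      (U t - ((U t).trace / 4) • (1 : Matrix (Fin 4) (Fin 4) ℝ))).trace / 4) •
                    (1 : Matrix (Fin 4) (Fin 4) ℝ))) e)) := by
  intro U W η η' t₁ t₂ e ht hU hW hWc hη hη'c hη₁ hη₂
  -- abbreviations: `P = 𝒰°`, `V = 𝒰'`, `f = ⟨𝒰°e, e⟩`, `f' = ⟨(𝒰' − (tr 𝒰'/4) I)e, e⟩`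
  set P : ℝ → Matrix (Fin 4) (Fin 4) ℝ := fun t =>
    U t - ((U t).trace / 4) • (1 : Matrix (Fin 4) (Fin 4) ℝ) with hP
  set V : ℝ → Matrix (Fin 4) (Fin 4) ℝ := fun t => -(-1 + W t) - U t * U t with hV
  set f : ℝ → ℝ := fun t => dotProduct e (Matrix.mulVec (P t) e) with hf
  set f' : ℝ → ℝ := fun t =>
    dotProduct e (Matrix.mulVec (V t - ((V t).trace / 4) • (1 : Matrix (Fin 4) (Fin 4) ℝ)) e)
    with hf'
  -- the landed extraction of `𝒲`
  have hweyl : ∀ t ∈ Icc t₁ t₂, W t = -(V t - ((V t).trace / 4) • (1 : Matrix (Fin 4) (Fin 4) ℝ))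
      - ((U t).trace / 2) • P t - (P t * P t - ((P t * P t).trace / 4) •
        (1 : Matrix (Fin 4) (Fin 4) ℝ)) :=
    fun t ht' => stub_weylTracefreeRiccati (U t) (V t) (W t) rfl (hW t ht')
  -- `f' = (d/dt) f`
  have hfd : ∀ t ∈ Icc t₁ t₂, HasDerivAt f (f' t) t := fun t ht' =>
    hasDerivAt_dotProduct_mulVec (hasDerivAt_tracefree (hU t ht')) e e
  -- continuity on the window
  have hUc : ContinuousOn U (Icc t₁ t₂) := by
    open scoped Matrix.Norms.Operator in
    exact fun t ht' => (hU t ht').continuousAt.continuousWithinAt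
  have hηc : ContinuousOn η (Icc t₁ t₂) := fun t ht' =>
    (hη t ht').continuousAt.continuousWithinAt
  have htf : Continuous fun M : Matrix (Fin 4) (Fin 4) ℝ =>
      M - (M.trace / 4) • (1 : Matrix (Fin 4) (Fin 4) ℝ) :=
    continuous_id.sub ((continuous_id.matrix_trace.div_const 4).smul continuous_const)
  have hquad : Continuous fun M : Matrix (Fin 4) (Fin 4) ℝ => dotProduct e (Matrix.mulVec M e) :=
    continuous_const.dotProduct (continuous_id.matrix_mulVec continuous_const)
  have hPc : ContinuousOn P (Icc t₁ t₂) := htf.comp_continuousOn hUc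
  have hVc : ContinuousOn V (Icc t₁ t₂) :=
    (continuousOn_const.add hWc).neg.sub (hUc.mul hUc)
  have hfc : ContinuousOn f (Icc t₁ t₂) := hquad.comp_continuousOn hPc
  have hf'c : ContinuousOn f' (Icc t₁ t₂) := hquad.comp_continuousOn (htf.comp_continuousOn hVc)
  have hPPc : ContinuousOn (fun t => dotProduct e (Matrix.mulVec (P t * P t -
      ((P t * P t).trace / 4) • (1 : Matrix (Fin 4) (Fin 4) ℝ)) e)) (Icc t₁ t₂) :=
    hquad.comp_continuousOn (htf.comp_continuousOn (hPc.mul hPc))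
  have hHc : ContinuousOn (fun t => (U t).trace) (Icc t₁ t₂) :=
    (continuous_id.matrix_trace :
      Continuous fun M : Matrix (Fin 4) (Fin 4) ℝ => M.trace).comp_continuousOn hUc
  have hII : ∀ {g : ℝ → ℝ}, ContinuousOn g (Icc t₁ t₂) → IntervalIntegrable g volume t₁ t₂ :=
    fun hg => ContinuousOn.intervalIntegrable (by rwa [uIcc_of_le ht])
  -- integration by parts: `∫ η f' = −∫ η' f`
  have hparts : ∫ t in t₁..t₂, η t * f' t = -∫ t in t₁..t₂, η' t * f t := by
    have h := intervalIntegral.integral_mul_deriv_eq_deriv_mul (a := t₁) (b := t₂)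
      (u := η) (v := f) (u' := η') (v' := f')
      (fun t ht' => hη t (by rwa [uIcc_of_le ht] at ht'))
      (fun t ht' => hfd t (by rwa [uIcc_of_le ht] at ht')) (hII hη'c) (hII hf'c)
    rw [h, hη₁, hη₂]
    ring
  -- pointwise: `η ⟨𝒲e,e⟩ = −η f' − η (H/2) f − η ⟨((𝒰°)² − …) e, e⟩`
  have hpt : ∀ t ∈ Icc t₁ t₂, η t * dotProduct e (Matrix.mulVec (W t) e) =
      -(η t * f' t) + (-(η t * ((U t).trace / 2) * f t) - η t * dotProduct e (Matrix.mulVec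
        (P t * P t - ((P t * P t).trace / 4) • (1 : Matrix (Fin 4) (Fin 4) ℝ)) e)) := by
    intro t ht'
    rw [hweyl t ht']
    simp only [hf, hf', Matrix.sub_mulVec, Matrix.neg_mulVec, Matrix.smul_mulVec,
      dotProduct_sub, dotProduct_neg, dotProduct_smul, smul_eq_mul]
    ring
  have h1 : ∫ t in t₁..t₂, η t * dotProduct e (Matrix.mulVec (W t) e) =
      ∫ t in t₁..t₂, (-(η t * f' t) + (-(η t * ((U t).trace / 2) * f t) - η t * dotProduct e
        (Matrix.mulVec (P t * P t - ((P t * P t).trace / 4) • (1 : Matrix (Fin 4) (Fin 4) ℝ)) e))) :=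
    intervalIntegral.integral_congr fun t ht' => hpt t (by rwa [uIcc_of_le ht] at ht')
  have hi1 : IntervalIntegrable (fun t => -(η t * f' t)) volume t₁ t₂ := (hII (hηc.mul hf'c)).neg
  have hi2 : IntervalIntegrable (fun t => -(η t * ((U t).trace / 2) * f t) - η t * dotProduct e
      (Matrix.mulVec (P t * P t - ((P t * P t).trace / 4) • (1 : Matrix (Fin 4) (Fin 4) ℝ)) e))
      volume t₁ t₂ :=
    (hII ((hηc.mul (hHc.div_const 2)).mul hfc)).neg.sub (hII (hηc.mul hPPc))
  have hi3 : IntervalIntegrable (fun t => η' t * f t) volume t₁ t₂ := hII (hη'c.mul hfc)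
  rw [h1, intervalIntegral.integral_add hi1 hi2, intervalIntegral.integral_neg, hparts, neg_neg,
    ← intervalIntegral.integral_add hi3 hi2]
  refine intervalIntegral.integral_congr fun t _ => ?_
  simp only [hf, hP]
  ring

end Summit.SmoothPoincare4.SmoothPoincare4.Cruxes.YamabePinchedEinsteinBulk.Sketch

end
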